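import Summits.PneNP.PneNP.Theorems.ConvexRankGatesLinAlgGateBlindHallCoverSmallDim
import Summits.PneNP.PneNP.Theorems.ConvexRankGatesLinAlgGateBlindKonigDuality
import Summits.PneNP.PneNP.Theorems.ConvexRankGatesLinAlgGateBlindLogWidthDoors
import Summits.PneNP.PneNP.Theorems.ConvexRankGatesLinAlgGateBlindLevelHost

/-!
# Route ConvexRankGates, crux `LinAlgGateBlind` (stmt-PneNP-10681): the Kőnig door — bipartite-matching (Edmonds) gates on `≤ m^{7/8-o(1)}` vertices, unconditionally

Support theorems for the crux (vocabulary of `Theorems/ConvexRankGatesLinAlgGateBlindDefs.lean`). The crux's definition of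
GRANK gates cites Edmonds' criterion — `K₀ = 0`, `K_{(a,b)} = E_{ab}`, `θ = d`: a perfect matching in a bipartite graph —
as the motivating example (`IsGRankGate`; `KÖNIG_s ⊆ GRANK_s`, `isGRankGate_of_matchingGate`). For GRANK gates in general
the tree's door stops at dimension / threshold `m^{7/16-o(1)}` (`sgAt_gRank_logWidth`, cover exponent `s²`); for the
matching gates themselves the Hall-violator cover of `sgAt_hallCover_of_cover_budget` (`…HallCoverSmallDim`, `N ≤ 4^d`) has
only `2d` bits, so at the logarithmic atom width the range is the full union-bound range `m^{7/8-o(1)}`, as for PERM: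

* `sgAt_hallCover_logWidth` — for every `c`, eventually in `m`, for every `d` with `2d ≤ m^{7/8}/(log₂ m)^5`, the single-gate
  statement for the inline class `HALLCOVER_d` (pattern data `P₀, P_i ⊆ [d'] × [d']`, `d' ≤ d`; REJECT iff a vertex cover
  `(A, W)` with `#A + #W < θ` covers `P₀ ∪ ⋃_{v_i = 1} P_i`);
* `konig_subset_hallCover` — the inline class `KÖNIG_d` (ACCEPT iff `P₀ ∪ ⋃_{v_i = 1} P_i` has `θ` cells in distinct rows and
  distinct columns — Edmonds' bipartite matching-number gates with pattern-valued inputs on `d' + d'` vertices, `d' ≤ d`)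
  is contained in `HALLCOVER_d` (Kőnig–Egerváry, `exists_matching_iff_forall_cover`);
* `isTermGate_hallCover_collapse`, `not_computes_clique_of_isOver_hallCover_logWidth`,
  `not_computes_clique_of_isOver_konig_logWidth` — by the level-`l` door theorem: NO circuit with `≤ m^c` gates over
  `{∧₂, ∨₂} ∪ HALLCOVER_d`, resp. `{∧₂, ∨₂} ∪ KÖNIG_d`, `2d ≤ m^{7/8}/(log₂ m)^5`, computes `CLIQUE(m, ⌈m^{1/8}⌉)`
  (unconditional; supersedes the width-`lOf m` range `4d ≤ m^{3/4}` of `sgAt_hallCover_of_dim_le`).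

Sources: Kőnig 1931 / Egerváry 1931 (duality), Edmonds 1967 §5 Thm. 1; Razborov 1985, Alon–Boppana 1987 §3; planting
theorem, host and budgets are the tree's. No new definitions (both classes written inline). [folklore]
-/

-- `Summit.PneNP.PneNP.…` duplicates `PneNP` BY DESIGN (single-problem summit).
set_option linter.dupNamespace false

noncomputable section

namespace Summit.PneNP.PneNP.Theorems

open Finset Filter Literature.Computability.Complexity Razborov
open Summit.PneNP.PneNP.Cruxes.LinAlgGateBlind.DnfInvariantWideGatesSeeSmallCliques
open Summit.PneNP.PneNP.Cruxes.LinAlgGateBlind.DnfInvariantWideGatesSeeSmallCliques.DenseRegime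

/-! ### Kőnig gates are Hall-cover gates -/

/-- **`KÖNIG_d ⊆ HALLCOVER_d` (Kőnig–Egerváry).** A gate accepting iff the live OR-pattern has a `θ`-matching rejects iff
some vertex cover with `< θ` vertices covers it (`exists_matching_iff_forall_cover`). [folklore] -/
theorem konig_subset_hallCover (d : ℕ) :
    {g : GateFn | ∃ d' θ : ℕ, d' ≤ d ∧ ∃ (P₀ : Set (Fin d' × Fin d')) (P : Fin g.1 → Set (Fin d' × Fin d')),
      ∀ v : Fin g.1 → Bool, g.2 v = true ↔ ∃ (r c : Fin θ → Fin d'), Function.Injective r ∧ Function.Injective c ∧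
        ∀ j, (r j, c j) ∈ {x : Fin d' × Fin d' | x ∈ P₀ ∨ ∃ i, v i = true ∧ x ∈ P i}} ⊆
    {g : GateFn | ∃ d' θ : ℕ, d' ≤ d ∧ ∃ (P₀ : Set (Fin d' × Fin d')) (P : Fin g.1 → Set (Fin d' × Fin d')),
      ∀ v : Fin g.1 → Bool, g.2 v = false ↔ ∃ A W : Finset (Fin d'), #A + #W < θ ∧
        ∀ x ∈ {x : Fin d' × Fin d' | x ∈ P₀ ∨ ∃ i, v i = true ∧ x ∈ P i}, x.1 ∈ A ∨ x.2 ∈ W} := by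
  rintro g ⟨d', θ, hd', P₀, P, hg⟩
  refine ⟨d', θ, hd', P₀, P, fun v => ?_⟩
  have hK := exists_matching_iff_forall_cover
    (fun a b => (a, b) ∈ {x : Fin d' × Fin d' | x ∈ P₀ ∨ ∃ i, v i = true ∧ x ∈ P i}) θ
  constructor
  · intro hv
    by_contra hno
    have hall : ∀ (A : Finset (Fin d')) (W : Finset (Fin d')),
        (∀ a b, (a, b) ∈ {x : Fin d' × Fin d' | x ∈ P₀ ∨ ∃ i, v i = true ∧ x ∈ P i} → a ∈ A ∨ b ∈ W) →
          θ ≤ #A + #W := by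
      intro A W hAW
      by_contra hlt
      exact hno ⟨A, W, by omega, fun x hx => hAW x.1 x.2 hx⟩
    have htrue : g.2 v = true := (hg v).2 (hK.2 hall)
    rw [hv] at htrue
    exact Bool.false_ne_true htrue
  · rintro ⟨A, W, hAW, hcov⟩
    cases hv : g.2 v
    · rfl
    · exfalso
      have hle := hK.1 ((hg v).1 hv) A W (fun a b hab => hcov (a, b) hab)
      omega

/-! ### The Hall-cover door at logarithmic width -/

/-- **`SGAt` for `HALLCOVER_d`, `2d ≤ m^{7/8}/(log₂ m)^5`, at the logarithmic width, at every level `c`, eventually in `m`**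
(range `4d ≤ m^{3/4}` at width `lOf m`, `sgAt_hallCover_of_dim_le`, → `m^{7/8-o(1)}`): the Hall-violator cover
`sgAt_hallCover_of_cover_budget` (`N ≤ 4^d = 2^{2d}`) with the budgets of `logWidth_common` at `T = 2d + Λ·L` and the cover
budget `4^d 2^{-(ν+1)} #𝒱(L) < ε` (`cover_budget_two_pow`). [folklore] -/
theorem sgAt_hallCover_logWidth : ∀ c : ℕ, ∀ᶠ m : ℕ in atTop, ∀ d : ℕ,
    2 * (d : ℝ) ≤ (m : ℝ) ^ (7 / 8 : ℝ) / Real.logb 2 m ^ 5 →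
      SGAt m (fun g => ∃ d' θ : ℕ, d' ≤ d ∧ ∃ (P₀ : Set (Fin d' × Fin d'))
        (P : Fin g.1 → Set (Fin d' × Fin d')), ∀ v : Fin g.1 → Bool, g.2 v = false ↔
          ∃ A W : Finset (Fin d'), #A + #W < θ ∧
            ∀ x ∈ {x | x ∈ P₀ ∨ ∃ i, v i = true ∧ x ∈ P i}, x.1 ∈ A ∨ x.2 ∈ W)
        ((2 * c + 8) * (Nat.log 2 m + 1)) (kOf m) (qOf m) (epsOf c m) := by
  intro c
  filter_upwards [logWidth_common c] with m hm d hd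
  have hT : (((2 * d + (Nat.log 2 m + 1) * ((2 * c + 8) * (Nat.log 2 m + 1)) : ℕ) : ℝ)) ≤
      16 * ((c : ℝ) + 4) * Real.logb 2 m ^ 2 * ((m : ℝ) ^ (7 / 8 : ℝ) / Real.logb 2 m ^ 5) := by
    obtain ⟨-, -, -, -, -, -, -, -, -, -, hℓ1, h5, hΛL⟩ := hm 0 (by
      push_cast
      exact mul_nonneg (mul_nonneg (by positivity) (sq_nonneg _))
        (div_nonneg (Real.rpow_nonneg (Nat.cast_nonneg m) _) (pow_nonneg (logb_two_nonneg m) 5)))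
    have hβ1 : 1 ≤ (m : ℝ) ^ (7 / 8 : ℝ) / Real.logb 2 m ^ 5 := by
      rw [le_div_iff₀ (by positivity), one_mul]; exact h5
    have hc0 : (0 : ℝ) ≤ c := Nat.cast_nonneg c
    have h8 : (2 : ℝ) ≤ 8 * ((c : ℝ) + 4) * Real.logb 2 m ^ 2 := by nlinarith
    push_cast
    set β := (m : ℝ) ^ (7 / 8 : ℝ) / Real.logb 2 m ^ 5 with hβ
    set P := 8 * ((c : ℝ) + 4) * Real.logb 2 m ^ 2 with hP
    have h1 : 2 * (d : ℝ) ≤ P * β := by nlinarith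
    have h2 : ((Nat.log 2 m : ℝ) + 1) * ((2 * (c : ℝ) + 8) * ((Nat.log 2 m : ℝ) + 1)) ≤ P * β := by nlinarith
    calc 2 * (d : ℝ) + ((Nat.log 2 m : ℝ) + 1) * ((2 * (c : ℝ) + 8) * ((Nat.log 2 m : ℝ) + 1))
        ≤ P * β + P * β := add_le_add h1 h2
      _ = 16 * ((c : ℝ) + 4) * Real.logb 2 m ^ 2 * β := by rw [hP]; ring
  obtain ⟨hm1, hq0, hq1, hhalf, hε, h2t, -, hpos, hB, hmΛ, -, -, -⟩ := hm _ hT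
  refine sgAt_hallCover_of_cover_budget m _ (kOf m) d _ _ (qOf m) (epsOf c m) hq0 hq1 hhalf hε h2t hpos ?_
  have hV := card_smallSets_le_two_pow m ((2 * c + 8) * (Nat.log 2 m + 1))
  have hVR : (#(smallSets (Fin m) ((2 * c + 8) * (Nat.log 2 m + 1))) : ℝ) ≤
      (2 : ℝ) ^ ((Nat.log 2 m + 1) * ((2 * c + 8) * (Nat.log 2 m + 1))) := by exact_mod_cast hV
  have h4 : (4 : ℝ) ^ d ≤ (2 : ℝ) ^ (2 * d) := by rw [pow_mul]; norm_num
  refine cover_budget_two_pow (Λ := Nat.log 2 m + 1) hm1 (by positivity) h4 hVR ?_ hmΛ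
  omega

/-! ### Monotonicity, collapse and the circuit lower bounds -/

/-- Hall-cover gates are monotone: a vertex cover of the larger live pattern covers the smaller one. [folklore] -/
theorem monotone_of_hallCover {d' θ : ℕ} (g : GateFn) (P₀ : Set (Fin d' × Fin d'))
    (P : Fin g.1 → Set (Fin d' × Fin d'))
    (hg : ∀ v : Fin g.1 → Bool, g.2 v = false ↔ ∃ A W : Finset (Fin d'), #A + #W < θ ∧
      ∀ x ∈ {x | x ∈ P₀ ∨ ∃ i, v i = true ∧ x ∈ P i}, x.1 ∈ A ∨ x.2 ∈ W) : Monotone g.2 := by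
  intro v w hvw
  cases hw : g.2 w
  · obtain ⟨A, W, hAW, hcov⟩ := (hg w).1 hw
    have hv : g.2 v = false := (hg v).2 ⟨A, W, hAW, fun x hx => hcov x (by
      rcases hx with hx | ⟨i, hi, hx⟩
      · exact Or.inl hx
      · exact Or.inr ⟨i, eq_true_of_le_of_eq_true (hvw i) hi, hx⟩)⟩
    rw [hv]
  · exact le_top

open Classical in
/-- **Collapse `HALLCOVER_d ∘ OR ⊆ HALLCOVER_d`.** A Hall-cover gate fed with small-clique DNFs `⌈A_i⌉`, `A_i ⊆ 𝒱(l)`, is a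
Hall-cover term gate over the atoms `X ∈ ⋃ A_i`: rewire the patterns, `P'_{(i,X)} := P_i` (same `d'`, `θ`, `P₀`); the
live OR-pattern is unchanged (`acceptsB_eq_true_iff_exists_atom`). [folklore] -/
theorem isTermGate_hallCover_collapse (m l d : ℕ) (g : GateFn) (A : Fin g.1 → Finset (Finset (Fin m)))
    (hA : ∀ i, A i ⊆ smallSets (Fin m) l)
    (hg : ∃ d' θ : ℕ, d' ≤ d ∧ ∃ (P₀ : Set (Fin d' × Fin d')) (P : Fin g.1 → Set (Fin d' × Fin d')),
      ∀ v : Fin g.1 → Bool, g.2 v = false ↔ ∃ A W : Finset (Fin d'), #A + #W < θ ∧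
        ∀ x ∈ {x | x ∈ P₀ ∨ ∃ i, v i = true ∧ x ∈ P i}, x.1 ∈ A ∨ x.2 ∈ W) :
    IsTermGate m (fun g' => ∃ d' θ : ℕ, d' ≤ d ∧ ∃ (P₀ : Set (Fin d' × Fin d'))
      (P : Fin g'.1 → Set (Fin d' × Fin d')), ∀ v : Fin g'.1 → Bool, g'.2 v = false ↔
        ∃ A W : Finset (Fin d'), #A + #W < θ ∧
          ∀ x ∈ {x | x ∈ P₀ ∨ ∃ i, v i = true ∧ x ∈ P i}, x.1 ∈ A ∨ x.2 ∈ W) l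
      (fun x => g.2 fun i => acceptsB (A i) x) := by
  obtain ⟨d', θ, hd', P₀, P, hgP⟩ := hg
  set e := Fintype.equivFin (Σ i : Fin g.1, {X // X ∈ A i}) with he
  set N := Fintype.card (Σ i : Fin g.1, {X // X ∈ A i}) with hN
  set π : Fin N → Fin g.1 := fun a => (e.symm a).1 with hπ
  -- the rewired gate: reject iff a small cover covers the live OR-pattern of the rewired data
  set R : (Fin N → Bool) → Prop := fun w => ∃ A' W : Finset (Fin d'), #A' + #W < θ ∧
    ∀ x ∈ {x : Fin d' × Fin d' | x ∈ P₀ ∨ ∃ a, w a = true ∧ x ∈ P (π a)}, x.1 ∈ A' ∨ x.2 ∈ W with hR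
  refine ⟨⟨N, fun w => decide (¬ R w)⟩, ⟨d', θ, hd', P₀, fun a => P (π a), fun w => ?_⟩,
    fun a => ((e.symm a).2 : Finset (Fin m)), fun a => hA _ (e.symm a).2.2, fun x => ?_⟩
  · change decide (¬ R w) = false ↔ R w
    rw [decide_eq_false_iff_not, not_not]
  · -- the live OR-patterns agree
    have hpat : {y : Fin d' × Fin d' | y ∈ P₀ ∨ ∃ i, (fun i => acceptsB (A i) x) i = true ∧ y ∈ P i} =
        {y : Fin d' × Fin d' | y ∈ P₀ ∨ ∃ a, (fun a => atomB ((e.symm a).2 : Finset (Fin m)) x) a = true ∧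
          y ∈ P (π a)} := by
      ext y
      simp only [Set.mem_setOf_eq]
      refine or_congr_right ?_
      constructor
      · rintro ⟨i, hi, hy⟩
        obtain ⟨a, ha, hat⟩ := (acceptsB_eq_true_iff_exists_atom A e x i).1 hi
        exact ⟨a, hat, by rw [hπ]; dsimp only; rw [ha]; exact hy⟩
      · rintro ⟨a, ha, hy⟩
        exact ⟨π a, (acceptsB_eq_true_iff_exists_atom A e x (π a)).2 ⟨a, rfl, ha⟩, hy⟩
    change g.2 (fun i => acceptsB (A i) x) = decide (¬ R fun a => atomB ((e.symm a).2 : Finset (Fin m)) x)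
    cases hv : g.2 (fun i => acceptsB (A i) x)
    · obtain ⟨A', W, hAW, hcov⟩ := (hgP _).1 hv
      symm
      rw [decide_eq_false_iff_not, not_not]
      refine ⟨A', W, hAW, fun y hy => hcov y ?_⟩
      rw [hpat]
      exact hy
    · symm
      rw [decide_eq_true_iff]
      rintro ⟨A', W, hAW, hcov⟩
      have hfalse : g.2 (fun i => acceptsB (A i) x) = false := (hgP _).2 ⟨A', W, hAW, fun y hy => hcov y (by
        rw [← hpat]; exact hy)⟩
      rw [hv] at hfalse
      exact Bool.noConfusion hfalse

/-- **No polynomial-size monotone circuit over `{∧₂, ∨₂} ∪ HALLCOVER_d`, `2d ≤ m^{7/8}/(log₂ m)^5`, computes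
`CLIQUE(m, ⌈m^{1/8}⌉)` (unconditional).** The level-`l` door theorem at `l = L(c,m)` with `monotone_of_hallCover`,
`isTermGate_hallCover_collapse` and `sgAt_hallCover_logWidth`. [folklore] -/
theorem not_computes_clique_of_isOver_hallCover_logWidth : ∀ c : ℕ, ∀ᶠ m : ℕ in atTop, ∀ d : ℕ,
    2 * (d : ℝ) ≤ (m : ℝ) ^ (7 / 8 : ℝ) / Real.logb 2 m ^ 5 →
    ∀ C : Circuit (KEdge m), C.IsOver ({GateFn.and 2, GateFn.or 2} ∪
      {g : GateFn | ∃ d' θ : ℕ, d' ≤ d ∧ ∃ (P₀ : Set (Fin d' × Fin d')) (P : Fin g.1 → Set (Fin d' × Fin d')),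
        ∀ v : Fin g.1 → Bool, g.2 v = false ↔ ∃ A W : Finset (Fin d'), #A + #W < θ ∧
          ∀ x ∈ {x : Fin d' × Fin d' | x ∈ P₀ ∨ ∃ i, v i = true ∧ x ∈ P i}, x.1 ∈ A ∨ x.2 ∈ W}) →
      C.size ≤ m ^ c → ¬ C.Computes (cliqueFn m ⌈(m : ℝ) ^ (1 / 8 : ℝ)⌉₊) := by
  intro c
  filter_upwards [not_computes_clique_of_collapse_level c, sgAt_hallCover_logWidth c, logWidth_le_lOf c]
    with m hhost hSG hLl d hd C hC hsize
  refine hhost ((2 * c + 8) * (Nat.log 2 m + 1)) (Nat.le_mul_of_pos_right _ (Nat.succ_pos _)) hLl _ _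
    (fun g hg => ?_) (fun g hg A hA => isTermGate_hallCover_collapse m _ d g A hA hg) (hSG d hd) C hC hsize
  obtain ⟨d', θ, -, P₀, P, hgP⟩ := hg
  exact monotone_of_hallCover g P₀ P hgP

/-- **No polynomial-size monotone circuit with Edmonds' bipartite matching-number gates on `≤ m^{7/8-o(1)}` vertices computes
`CLIQUE(m, ⌈m^{1/8}⌉)` (unconditional).** For every `c`, eventually in `m`, for every `d` with `2d ≤ m^{7/8}/(log₂ m)^5` and
every circuit `C` with `≤ m^c` gates over `{∧₂, ∨₂} ∪ KÖNIG_d` — gates accepting iff the OR-pattern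
`P₀ ∪ ⋃_{v_i = 1} P_i ⊆ [d'] × [d']`, `d' ≤ d`, has `θ` cells in pairwise distinct rows and columns (a `θ`-matching;
unbounded fan-in, any patterns, any threshold): `¬ C.Computes CLIQUE(m, ⌈m^{1/8}⌉)` (`konig_subset_hallCover` and
`not_computes_clique_of_isOver_hallCover_logWidth`). These are the motivating GRANK gates of the crux (Edmonds 1967:
`K_{(a,b)} = E_{ab}`) — for which the GRANK door (`sgAt_gRank_logWidth`, threshold `≤ m^{7/16-o(1)}`) is thus not the last
word. [folklore] -/
theorem not_computes_clique_of_isOver_konig_logWidth : ∀ c : ℕ, ∀ᶠ m : ℕ in atTop, ∀ d : ℕ,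
    2 * (d : ℝ) ≤ (m : ℝ) ^ (7 / 8 : ℝ) / Real.logb 2 m ^ 5 →
    ∀ C : Circuit (KEdge m), C.IsOver ({GateFn.and 2, GateFn.or 2} ∪
      {g : GateFn | ∃ d' θ : ℕ, d' ≤ d ∧ ∃ (P₀ : Set (Fin d' × Fin d')) (P : Fin g.1 → Set (Fin d' × Fin d')),
        ∀ v : Fin g.1 → Bool, g.2 v = true ↔ ∃ (r c : Fin θ → Fin d'), Function.Injective r ∧ Function.Injective c ∧
          ∀ j, (r j, c j) ∈ {x : Fin d' × Fin d' | x ∈ P₀ ∨ ∃ i, v i = true ∧ x ∈ P i}}) →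
      C.size ≤ m ^ c → ¬ C.Computes (cliqueFn m ⌈(m : ℝ) ^ (1 / 8 : ℝ)⌉₊) := by
  intro c
  filter_upwards [not_computes_clique_of_isOver_hallCover_logWidth c] with m hm d hd C hC hsize
  exact hm d hd C (hC.mono (Set.union_subset_union_right _ (konig_subset_hallCover d))) hsize

end Summit.PneNP.PneNP.Theorems

end
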